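import Literature.Computability.AlgebraicComplexity.SparseMultiples
import Mathlib.Algebra.MvPolynomial.Equiv
import Mathlib.Algebra.Polynomial.Degree.Operations
import Mathlib.Algebra.Polynomial.Degree.TrailingDegree
import Mathlib.Algebra.Order.BigOperators.Group.Finset
import HarnessLib

/-!
# Proof of `FSTW2016_sparsity_of_multiples` (Oliveira; FSTW, Prop. 74)

Discharges the named fact
`Literature.Computability.AlgebraicComplexity.FSTW2016_sparsity_of_multiples` (file
`SparseMultiples.lean`): M. A. Forbes, A. Shpilka, I. Tzameret, A. Wigderson, *Proof
complexity lower bounds from algebraic circuit complexity*, Theory of Computing 17(10) (2021)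
1–88, **Proposition 6.14** (pp. 61–62; = arXiv:1606.05050 Prop. 74; attributed to Oliveira,
CCC 2015):

> "Let `f(x) ∈ 𝔽[x_1, …, x_n]` be a nonzero multilinear polynomial with sparsity exactly `s`.
> Then any nonzero multiple of `f` has sparsity `≥ s`."

We follow the printed proof (induction on the number of variables): single out the variable
`x_0` via `MvPolynomial.finSuccEquiv`, so that a polynomial in `n + 1` variables becomes a
univariate polynomial `P` over `MvPolynomial (Fin n) F`; its sparsity is the sum of the
sparsities of the coefficients of `P` ("partitioning by powers of `z` so that there is no
cancellation"). For multilinear `f`, `P = f₁ z + f₀` and `s = s₀ + s₁`; for `g ≠ 0` with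
extreme `z`-degrees `d₀ ≤ d₁`, the coefficients of `z^{d₁+1}` and `z^{d₀}` in `g f` are
`g_{d₁} f₁` and `g_{d₀} f₀`; discarding the middle terms and the induction hypothesis give the
bound. The only deviation from print: the induction is run without the hypothesis `f ≠ 0`
(the case `f = 0` is trivial), which makes the cases `f₀ = 0` / `f₁ = 0` uniform; the field
hypothesis is used only in the base case (`g f ≠ 0`).

## References

* [ForbesShpilkaTzameretWigderson2021] Theory of Computing 17(10) (2021), Prop. 6.14, pp. 61–62
  (= arXiv:1606.05050 §7 Prop. 74).
-/

namespace Literature.Computability.AlgebraicComplexity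

open MvPolynomial

section Proof

variable {R : Type*} [CommSemiring R] {n : ℕ}

/-- Sparsity of `p ∈ R[x_0,…,x_n]` is the sum over the powers `i` of `x_0` of the sparsities of
the coefficients of `x_0^i` (viewing `p` in `R[x_1,…,x_n][x_0]` via `finSuccEquiv`), for any
finite set `t` of exponents containing all `x_0`-exponents occurring in `p`. [folklore] -/
private theorem card_support_eq_sum_card_support_coeff (p : MvPolynomial (Fin (n + 1)) R)
    {t : Finset ℕ} (ht : ∀ m ∈ p.support, m 0 ∈ t) :
    p.support.card = ∑ i ∈ t, ((finSuccEquiv R n p).coeff i).support.card := by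
  rw [Finset.card_eq_sum_card_fiberwise (f := fun m : Fin (n + 1) →₀ ℕ => m 0)
    (fun m hm => ht m (Finset.mem_coe.1 hm))]
  refine Finset.sum_congr rfl fun i _ => ?_
  rw [← image_support_finSuccEquiv,
    Finset.card_image_of_injective _ (Finsupp.cons_right_injective i)]

/-- "Discarding the middle terms": the sparsities of two distinct `x_0`-coefficients of `p` add up
to at most the sparsity of `p`. [folklore] -/
private theorem card_support_coeff_add_card_support_coeff_le (p : MvPolynomial (Fin (n + 1)) R)
    {i j : ℕ} (hij : i ≠ j) :
    ((finSuccEquiv R n p).coeff i).support.card + ((finSuccEquiv R n p).coeff j).support.card ≤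
      p.support.card := by
  classical
  have ht : ∀ m ∈ p.support, m 0 ∈ insert i (insert j ((finSuccEquiv R n p).support)) := by
    intro m hm
    refine Finset.mem_insert_of_mem (Finset.mem_insert_of_mem ?_)
    rw [support_finSuccEquiv]
    exact Finset.mem_image_of_mem _ hm
  rw [card_support_eq_sum_card_support_coeff p ht]
  calc ((finSuccEquiv R n p).coeff i).support.card + ((finSuccEquiv R n p).coeff j).support.card
      = ∑ k ∈ {i, j}, ((finSuccEquiv R n p).coeff k).support.card :=
        (Finset.sum_pair (f := fun k => ((finSuccEquiv R n p).coeff k).support.card) hij).symm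
    _ ≤ _ := Finset.sum_le_sum_of_subset
        (Finset.insert_subset_insert i (Finset.singleton_subset_iff.2 (Finset.mem_insert_self _ _)))

/-- For multilinear `f`, writing `f = f₁ x_0 + f₀`: `s = s₀ + s₁`. [folklore] -/
private theorem card_support_eq_of_multilinear (f : MvPolynomial (Fin (n + 1)) R)
    (hf : ∀ d ∈ f.support, ∀ i, d i ≤ 1) :
    f.support.card = ((finSuccEquiv R n f).coeff 0).support.card +
      ((finSuccEquiv R n f).coeff 1).support.card := by
  have ht : ∀ m ∈ f.support, m 0 ∈ ({0, 1} : Finset ℕ) := by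
    intro m hm
    have h := hf m hm 0
    simp only [Finset.mem_insert, Finset.mem_singleton]
    omega
  rw [card_support_eq_sum_card_support_coeff f ht, Finset.sum_pair zero_ne_one]

/-- The `x_0`-coefficients of a multilinear polynomial are multilinear. [folklore] -/
private theorem multilinear_coeff_finSuccEquiv (f : MvPolynomial (Fin (n + 1)) R)
    (hf : ∀ d ∈ f.support, ∀ i, d i ≤ 1) (i : ℕ) :
    ∀ d ∈ ((finSuccEquiv R n f).coeff i).support, ∀ j, d j ≤ 1 := by
  intro d hd j
  have h := hf _ (mem_support_coeff_finSuccEquiv.1 hd) j.succ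
  rwa [Finsupp.cons_succ] at h

/-- A multilinear polynomial has `x_0`-degree at most `1`. [folklore] -/
private theorem natDegree_finSuccEquiv_le_one_of_multilinear (f : MvPolynomial (Fin (n + 1)) R)
    (hf : ∀ d ∈ f.support, ∀ i, d i ≤ 1) : (finSuccEquiv R n f).natDegree ≤ 1 := by
  rw [natDegree_finSuccEquiv, degreeOf_le_iff]
  exact fun m hm => hf m hm 0

/-- The coefficient of `z^{d₀}` in `G * P`, `d₀` the trailing degree of `G`, is `G_{d₀} P_0`.
[folklore] -/
private theorem coeff_mul_natTrailingDegree {A : Type*} [CommSemiring A] (G P : Polynomial A) :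
    (G * P).coeff G.natTrailingDegree = G.coeff G.natTrailingDegree * P.coeff 0 := by
  rw [Polynomial.coeff_mul,
    Finset.sum_eq_single_of_mem (G.natTrailingDegree, 0) (by simp [Finset.mem_antidiagonal])]
  rintro ⟨i, j⟩ hmem hne
  rw [Finset.mem_antidiagonal] at hmem
  have hi : i < G.natTrailingDegree := by
    rcases Nat.lt_or_ge i G.natTrailingDegree with h | h
    · exact h
    · exfalso
      apply hne
      simp only [Prod.mk.injEq]
      omega
  rw [Polynomial.coeff_eq_zero_of_lt_natTrailingDegree hi, zero_mul]

/-- The induction of FSTW Prop. 6.14 (with the hypothesis `f ≠ 0` dropped, the case `f = 0` being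
trivial): over a field, a multilinear `f` has at most the sparsity of any of its multiples by a
nonzero `g`. [cite: ForbesShpilkaTzameretWigderson2021, Prop. 74] -/
private theorem card_support_le_card_support_mul_of_multilinear (F : Type) [Field F] :
    ∀ (n : ℕ) (f g : MvPolynomial (Fin n) F),
      (∀ d ∈ f.support, ∀ i, d i ≤ 1) → g ≠ 0 → f.support.card ≤ (g * f).support.card := by
  intro n
  induction n with
  | zero =>
    intro f g _ hg
    by_cases hf0 : f = 0
    · simp [hf0]
    · calc f.support.card
          ≤ 1 := Finset.card_le_one.mpr fun a _ b _ => Subsingleton.elim a b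
        _ ≤ (g * f).support.card :=
          Finset.card_pos.mpr (support_nonempty.mpr (mul_ne_zero hg hf0))
  | succ n ih =>
    intro f g hf hg
    -- `z := x_0`, `P := f` and `G := g` as polynomials in `z` over `F[x_1, …, x_n]`.
    set P := finSuccEquiv F n f with hP
    set G := finSuccEquiv F n g with hG
    have hG0 : G ≠ 0 := (EmbeddingLike.map_ne_zero_iff).mpr hg
    -- the extreme `z`-degrees `d₀ ≤ d₁` of `g` and the corresponding (nonzero) coefficients
    have hlead : G.coeff G.natDegree ≠ 0 := Polynomial.leadingCoeff_ne_zero.mpr hG0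
    have htrail : G.coeff G.natTrailingDegree ≠ 0 :=
      Polynomial.trailingCoeff_nonzero_iff_nonzero.mpr hG0
    have hne : G.natTrailingDegree ≠ G.natDegree + 1 := by
      have h := Polynomial.natTrailingDegree_le_natDegree G
      omega
    -- the `z^{d₁+1}` and `z^{d₀}` coefficients of `g f`
    have h1 : (G * P).coeff (G.natDegree + 1) = G.coeff G.natDegree * P.coeff 1 :=
      Polynomial.coeff_mul_add_eq_of_natDegree_le le_rfl
        (natDegree_finSuccEquiv_le_one_of_multilinear f hf)
    have h0 : (G * P).coeff G.natTrailingDegree = G.coeff G.natTrailingDegree * P.coeff 0 :=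
      coeff_mul_natTrailingDegree G P
    -- induction hypothesis for `f₀`, `f₁`
    have ih0 := ih (P.coeff 0) (G.coeff G.natTrailingDegree)
      (multilinear_coeff_finSuccEquiv f hf 0) htrail
    have ih1 := ih (P.coeff 1) (G.coeff G.natDegree)
      (multilinear_coeff_finSuccEquiv f hf 1) hlead
    calc f.support.card = (P.coeff 0).support.card + (P.coeff 1).support.card :=
          card_support_eq_of_multilinear f hf
      _ ≤ (G.coeff G.natTrailingDegree * P.coeff 0).support.card +
            (G.coeff G.natDegree * P.coeff 1).support.card := Nat.add_le_add ih0 ih1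
      _ = ((finSuccEquiv F n (g * f)).coeff G.natTrailingDegree).support.card +
            ((finSuccEquiv F n (g * f)).coeff (G.natDegree + 1)).support.card := by
          rw [map_mul, ← hP, ← hG, h0, h1]
      _ ≤ (g * f).support.card := card_support_coeff_add_card_support_coeff_le (g * f) hne

end Proof

/-- **Discharge of `FSTW2016_sparsity_of_multiples`** (FSTW, ToC 17(10) 2021, Prop. 6.14,
pp. 61–62 = arXiv:1606.05050 Prop. 74, after Oliveira 2015): nonzero multiples of a nonzero
multilinear polynomial of sparsity `s` have sparsity `≥ s`. Proof = the printed induction on the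
number of variables. [cite: ForbesShpilkaTzameretWigderson2021, Prop. 74] -/
theorem FSTW2016_sparsity_of_multiples_holds : FSTW2016_sparsity_of_multiples :=
  fun F _ n f g _ hf hg => card_support_le_card_support_mul_of_multilinear F n f g hf hg

end Literature.Computability.AlgebraicComplexity
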